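import Summits.QuantumFields.BalabanUV.T4Continuum.Spine.NE3.PairFrameCondition
import Summits.QuantumFields.BalabanUV.T4Continuum.Spine.NE3.RemainderTowerPrepB8
import Summits.QuantumFields.BalabanUV.T4Continuum.Spine.NE3.SupplierB8SfClassPrep
import Literature.MathematicalPhysics.QuantumFieldTheory.Balaban1983to89.B8Eq166ConstraintPair
import HarnessLib

/-!
# T⁴ programme, node NE3 (pub-ymgap DAG node N16) — [B8] THEOREM 4's HYPOTHESES (1.34) ∕ (1.66) AT THE MINIMISER PAIR: the PINNED axial
# pre-gauge of `U_A` relative to `W = rescale L (bavg L U_B)` over the small-field class — unitary, `(N·Lᵏ)`-periodic, `u₀(Lᵏz) = 1`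
# (so `\overline{U_A^{u₀}}ᵏ = V` is KEPT), (1.19) relative to `W` at every block of every level, and `|Ũ′ʲ_b − 1| < 11d²α` on EVERY bond of
# EVERY level `j ≤ k` — from class membership ALONE (`PairAxialGaugeB8`)

Cell `pub-ymgap`, HUMAN RULING D-0062 (YM Track A at full width), seat `pub-ymgap-dag-n16-b` (FIRST-MISSING-ESTIMATE for N16 = NE3;
writer prover-pub-ymgap-dag-n16-b-g0-0, 2026-08-25).  The NE3-pair READING of the Literature module
`Balaban1983to89.B8Eq166ConstraintPair` (landed p409263): its pinned twisted axial gauge `ptw` and the theorems `pinnedTwistedFix_global`,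
`inAx_pinnedTwistedFix`, `avgIter_pinnedTwistedFix_eq`, `ineq165_pair`, `ineq166_pair`, `fine_pair` instantiated at `U₀ := W = rescale L (bavg L U_B)`,
`U := U_A`, `G := unitaryUnits`, for `U_A` a run-`k` minimiser and `U_B` a run-`(k+1)` minimiser over B11's everywhere-small-field class
`MinimalActionRate.sfClass d L N ε` with the SAME datum `V` (so `Ū_Aᵏ = V = W̄ᵏ`, `PairFrameCondition.avgIter_rescale_bavg_eq_of_isMinimiser`),
`U_B` `(b, g)`-regular (`MinimalActionRate.Regular`, whence `W ∈ sfClass d L N (b + 226(8(d+1)(d+4))²b²) k` by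
`MinimalActionRate.rescale_bavg_mem_sfClass`) — exactly the quantifier prefix of row NE3's `PairLandauB8.PairLandauGaugeB8(Avg)`.

WHAT (one theorem, [folklore] over the tree BY NAME; 0 def, 0 sorry): **`exists_pairAxialGauge`** — for `d ≥ 1`, `L ≥ 2`, a common bound
`α` of the two plaquette radii (`ε < α`, `b + 226(8(d+1)(d+4))²b² < α`) in the Prop. 1∕2 regime of [Balaban1985Averaging] (`C₀α ≤ ⅓`,
`2α ≤ c₂′`) and Lemma 1's (`11d²α ≤ 1∕6`), and every such pair: ∃ `u₀` (:= `ptw L W U_A k`) with `IsUnitarySite u₀`, `IsPeriodicSite u₀ (N·Lᵏ)`, `u₀(Lᵏz) = 1`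
for all `z`, `U_A^{u₀}` unitary with `pdev` unchanged, (1.19) relative to `W` between all consecutive levels at every block (and
`U_A^{u₀} ∈ Ax_k(ℭ, W)` for every `ℭ`, `B8Eq119TwistedAxial.InAx`), `\overline{U_A^{u₀}}ᵏ = V`, and on EVERY bond of EVERY level `j = k − n`:
`|\overline{U_A^{u₀}}ʲ_b − W̄ʲ_b| < 11d²α`, `|Ũ′ʲ_b − 1| < 11d²α`; on the fine lattice `|U_A^{u₀}(b) − W(b)| < 11d²α` and `|W(b)⁻¹U_A^{u₀}(b) − 1| < 11d²α`
— the last being LITERALLY the binder `hr₀` (with `hu₀c`, `hrep₀`-shape data) of `Spine/NE3/FrameNormalisation.exists_frameNormalised'` ∕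
`FrameNormalisationMembers.members_of_pair` and the relative datum of the Landau step `Spine/NE3/CurvedLandauRep.exists_landauRep_W`
([B8] Prop. 5 TYPE), at (0)-size `r₀ = 11d²α`.

PRINTED LOCI (as printed; [Balaban1985RegularSpaces] = B8, CMP 99 (1985) 75–102): (1.14) p. 78 «u(y) = 1 for y ∈ 𝔅_k»; (1.19)–(1.20)
p. 79 (the axial gauge `Ax_k(𝔅_k, U₀)`); (1.34) p. 82 «U′U₀ ∈ 𝔄_k({Ω_j}, α₀) ∩ Ax_k(𝔅_k, U₀)»; (1.35) p. 82 «It is satisfied if V is close to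
Ū₀ʲ, more precisely if |V − Ū₀ʲ| < α₁»; (1.65)–(1.66) p. 87 «|(\overline{U′U₀})ʲ − Ū₀ʲ| = |Ũ′ʲ − 1| < 11d²α₀ + α₁ on Ω_j^{(j)}»; Theorem 4
p. 88.  [Balaban1985Variational] (13) p. 280: «U₀ ∈ 𝔘_k({Ω_j}, B₃L³ε₁) ∩ 𝔅_k(𝔅_k, V), hence U₀ should be close to the minimal configuration».

HONEST FRAMING (page 1): bookkeeping over landed theorems; the (0)-size pre-gauge datum only — the (−1)-size bound `|A| < B′₁(α₀+α₁)(Lʲη)⁻¹`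
IS [B8] Theorem 4 (pp. 88–97) and is NOT proved here or anywhere in the tree; `PairLandauGaugeB8Avg`, the covariant root, NE3, NE7 NOT
proved; spine 0∕9; finite T⁴ rung (B)+1 at fixed ε — NOT infinite volume, NOT mass gap, NOT `BetaPertH`, NOT Clay.  PLACEMENT: next to
row NE3's ENDs, `Spine/NE3/`.
-/

set_option autoImplicit false

open scoped BigOperators Matrix Matrix.Norms.L2Operator
open NormedSpace

namespace Summit.QuantumFields.BalabanUV.T4Continuum.NE3.PairAxialGaugeB8

open Literature.MathematicalPhysics.QuantumFieldTheory.Balaban1983to89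
open B7Prop1Explicit B7Prop2Explicit
open B7AvgGaugeCovariance (uLev)
open B8Lemma1NonAbelian (pert)
open B8Eq119TwistedAxial (InAx)
open B8Eq166ConstraintPair (ptw ptw_periodic pinnedTwistedFix_global inAx_pinnedTwistedFix avgIter_pinnedTwistedFix_eq ineq165_pair
  ineq166_pair fine_pair)
open B12Ineq417Flat (shiftCfg)
open T4AveragingDeficitWall (IsUnitaryCfg SmallField)
open T4AveragingDeficitWallBoundary (IsPeriodicCfg)
open MinimalActionSandwich (IsMinimiser)
open MinimalActionRate (Regular sfClass rescale_bavg_mem_sfClass)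
open NE3EnergyShapes (IsUnitarySite IsPeriodicSite)
open NE3.PairFrameCondition (avgIter_eq_of_isMinimiser avgIter_rescale_bavg_eq_of_isMinimiser)
open NE3.RemainderTowerPrepB8 (shiftCfg_of_isPeriodicCfg)
open NE3.SupplierB8SfClassPrep (pdev_le_of_smallField)

noncomputable section

variable {d : ℕ} {n : Type*} [Fintype n] [DecidableEq n]

omit [Fintype n] [DecidableEq n] in
/-- `a / t² < α · (t⁻¹)²` for `a < α`, `1 ≤ t`. [folklore] -/
private theorem div_sq_lt {a α t : ℝ} (h : a < α) (ht : 1 ≤ t) : a / t ^ 2 < α * (t⁻¹) ^ 2 := by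
  have ht0 : 0 < t := by linarith
  rw [inv_pow, ← div_eq_mul_inv]
  exact div_lt_div_of_pos_right h (by positivity)

/-- For a unitary `w` and any `x`: `‖w⁻¹x − 1‖ = ‖x − w‖` (left multiplication by a unitary is an isometry). [folklore] -/
private theorem norm_inv_mul_sub_one {w : (Matrix n n ℂ)ˣ} (hw : w ∈ unitaryUnits (Matrix n n ℂ)) (x : Matrix n n ℂ) :
    ‖((w⁻¹ : (Matrix n n ℂ)ˣ) : Matrix n n ℂ) * x - 1‖ = ‖x - (w : Matrix n n ℂ)‖ := by
  letI : CStarAlgebra (Matrix n n ℂ) := {}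
  have hw' : ((w⁻¹ : (Matrix n n ℂ)ˣ) : Matrix n n ℂ) ∈ unitary (Matrix n n ℂ) :=
    mem_unitaryUnits.mp ((unitaryUnits (Matrix n n ℂ)).inv_mem hw)
  have h : ((w⁻¹ : (Matrix n n ℂ)ˣ) : Matrix n n ℂ) * x - 1 = ((w⁻¹ : (Matrix n n ℂ)ˣ) : Matrix n n ℂ) * (x - (w : Matrix n n ℂ)) := by
    rw [mul_sub, Units.inv_mul]
  rw [h, CStarRing.norm_mem_unitary_mul _ hw']

/-- **[B8] THEOREM 4's HYPOTHESES (1.34) ∕ (1.66) AT THE MINIMISER PAIR — THE PINNED AXIAL PRE-GAUGE OF `U_A` RELATIVE TO `W = rescale L (bavg L U_B)`.**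
For `d ≥ 1`, `L ≥ 2`, radii `ε` (class) and `b` (regularity, with the one-step transport line `512(d+1)(d+4)L²b ≤ 1`) below a common `α`
in the Prop. 1∕2 regime of [Balaban1985Averaging] and Lemma 1's regime (`C₀α ≤ ⅓`, `2α ≤ c₂′`, `11d²α ≤ 1∕6`), and EVERY pair `U_A` = run-`k`
minimiser, `U_B` = `(b, g)`-regular run-`(k+1)` minimiser over `sfClass d L N ε` with the same datum `V`: there is a unitary `(N·Lᵏ)`-periodic
site gauge `u₀`, `u₀(Lᵏz) = 1` for all `z`, such that `U_A^{u₀}` is unitary with the same plaquette deviation, satisfies (1.19) relative to `W`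
between ALL consecutive levels at EVERY block (so `U_A^{u₀} ∈ Ax_k(ℭ, W)` for every `ℭ`), keeps the constraint `\overline{U_A^{u₀}}ᵏ = V`
((1.35) with `α₁ = 0`), and on every bond of every level `j = k − n ≤ k`: `|\overline{U_A^{u₀}}ʲ_b − W̄ʲ_b| < 11d²α` and `|Ũ′ʲ_b − 1| < 11d²α`
((1.65)∕(1.66) with `α₁ = 0`); on the fine lattice `|U_A^{u₀}(b) − W(b)| < 11d²α` and `|W(b)⁻¹·U_A^{u₀}(b) − 1| < 11d²α` (the `hr₀`-datum of
`FrameNormalisation.exists_frameNormalised'` ∕ `CurvedLandauRep.exists_landauRep_W`, at (0)-size). [folklore] -/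
theorem exists_pairAxialGauge [Nonempty n] (hd : 1 ≤ d) {L N : ℕ} (hL : 2 ≤ L) {ε b g α : ℝ} (hε : 0 ≤ ε) (hb : 0 ≤ b)
    (hbs : 512 * (d + 1) * (d + 4) * (L : ℝ) ^ 2 * b ≤ 1) (hα : 0 < α) (hεα : ε < α)
    (hbα : b + 226 * (8 * (d + 1) * (d + 4)) ^ 2 * b ^ 2 < α)
    (hα3 : C0 d * α ≤ 1 / 3) (hα2 : 2 * α ≤ c2' d L) (hsmall : 11 * (d : ℝ) ^ 2 * α ≤ 1 / 6)
    {k : ℕ} {V UA UB : Site d → Fin d → (Matrix n n ℂ)ˣ}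
    (hA : IsMinimiser d (sfClass d L N ε) L N k V UA) (hB : IsMinimiser d (sfClass d L N ε) L N (k + 1) V UB)
    (hreg : Regular d L N b g (k + 1) UB) :
    ∃ u₀ : Site d → (Matrix n n ℂ)ˣ,
      IsUnitarySite u₀ ∧ IsPeriodicSite u₀ ((N * L ^ k : ℕ) : ℤ) ∧ (∀ z : Site d, u₀ (((L : ℤ) ^ k) • z) = 1) ∧
      IsUnitaryCfg (gaugeAct u₀ UA) ∧ pdev (gaugeAct u₀ UA) = pdev UA ∧
      (∀ m, m < k → ∀ (z : Site d) (r : Fin d → Fin L),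
        axialFn (avgIter L (gaugeAct u₀ UA) (k - (m + 1))) ((L : ℤ) • z) ((L : ℤ) • z + boxVec L r) =
          axialFn (avgIter L (rescale L (bavg L UB)) (k - (m + 1))) ((L : ℤ) • z) ((L : ℤ) • z + boxVec L r)) ∧
      (∀ Λ : ℕ → Set (Site d), InAx L k Λ (rescale L (bavg L UB)) (gaugeAct u₀ UA)) ∧
      avgIter L (gaugeAct u₀ UA) k = V ∧
      (∀ m, m ≤ k → ∀ (x : Site d) (ν : Fin d),
        ‖((avgIter L (gaugeAct u₀ UA) (k - m) x ν : (Matrix n n ℂ)ˣ) : Matrix n n ℂ) - avgIter L (rescale L (bavg L UB)) (k - m) x ν‖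
          < 11 * (d : ℝ) ^ 2 * α) ∧
      (∀ m, m ≤ k → ∀ (x : Site d) (ν : Fin d),
        ‖((pert (avgIter L (gaugeAct u₀ UA) (k - m)) (avgIter L (rescale L (bavg L UB)) (k - m)) x ν : (Matrix n n ℂ)ˣ) : Matrix n n ℂ) - 1‖
          < 11 * (d : ℝ) ^ 2 * α) ∧
      (∀ (x : Site d) (ν : Fin d), ‖((gaugeAct u₀ UA x ν : (Matrix n n ℂ)ˣ) : Matrix n n ℂ) - rescale L (bavg L UB) x ν‖ < 11 * (d : ℝ) ^ 2 * α) ∧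
      (∀ (x : Site d) (ν : Fin d),
        ‖(((rescale L (bavg L UB) x ν)⁻¹ : (Matrix n n ℂ)ˣ) : Matrix n n ℂ) * (gaugeAct u₀ UA x ν : (Matrix n n ℂ)ˣ) - 1‖ < 11 * (d : ℝ) ^ 2 * α) := by
  letI : CStarAlgebra (Matrix n n ℂ) := {}
  have hL1 : 1 ≤ L := le_trans (by norm_num) hL
  have hL1r : (1 : ℝ) ≤ L := by exact_mod_cast hL1
  have hLk : (1 : ℝ) ≤ (L : ℝ) ^ k := one_le_pow₀ hL1r
  have hG := avgClosed_unitaryUnits d (𝔸 := Matrix n n ℂ) L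
  set W : Site d → Fin d → (Matrix n n ℂ)ˣ := rescale L (bavg L UB) with hWdef
  -- class data of the pair
  obtain ⟨hAu, hAP, hAsm⟩ := hA.mem.1
  have hWcl : W ∈ sfClass d L N (b + 226 * (8 * (d + 1) * (d + 4)) ^ 2 * b ^ 2) k :=
    rescale_bavg_mem_sfClass hL1 hb hbs le_rfl hreg
  obtain ⟨hWu, hWP, hWsm⟩ := hWcl
  have hb' : 0 ≤ b + 226 * (8 * (d + 1) * (d + 4)) ^ 2 * b ^ 2 := by positivity
  have h34 : pdev UA < α * (((L : ℝ) ^ k)⁻¹) ^ 2 :=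
    (pdev_le_of_smallField (div_nonneg hε (by positivity)) hAsm).trans_lt (div_sq_lt hεα hLk)
  have h33 : pdev W < α * (((L : ℝ) ^ k)⁻¹) ^ 2 :=
    (pdev_le_of_smallField (div_nonneg hb' (by positivity)) hWsm).trans_lt (div_sq_lt hbα hLk)
  have hAshift : ∀ i : Fin d, shiftCfg (((N * L ^ k : ℕ) : ℤ) • e i) UA = UA := fun i => shiftCfg_of_isPeriodicCfg hAP (e i)
  have hWshift : ∀ i : Fin d, shiftCfg (((N * L ^ k : ℕ) : ℤ) • e i) W = W := fun i => shiftCfg_of_isPeriodicCfg hWP (e i)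
  have hpair : avgIter L UA k = avgIter L W k := by
    rw [avgIter_eq_of_isMinimiser hA, hWdef, avgIter_rescale_bavg_eq_of_isMinimiser hB]
  obtain ⟨huG, hUuG, hpdev, hutop, h19, -⟩ := pinnedTwistedFix_global L hL hG k W UA hWu hAu hα hα3 hα2 h33 h34
  refine ⟨ptw L W UA k, huG, fun x i => ptw_periodic hL1 N k hWshift hAshift x i, hutop, hUuG, hpdev, h19,
    fun Λ => inAx_pinnedTwistedFix L hL hG k W UA hWu hAu hα hα3 hα2 h33 h34 Λ, ?_, fun m hm x ν => ?_,
    fun m hm x ν => ineq166_pair L hL hd hG k W UA hWu hAu hα hα3 hα2 h33 h34 hpair hsmall m hm x ν,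
    fun x ν => (fine_pair L hL hd hG k W UA hWu hAu hα hα3 hα2 h33 h34 hpair hsmall x ν).2, fun x ν => ?_⟩
  · rw [avgIter_pinnedTwistedFix_eq L hL hG k W UA hWu hAu hα hα3 hα2 h33 h34 hpair, hWdef, avgIter_rescale_bavg_eq_of_isMinimiser hB]
  · have h := ineq165_pair L hL hd hG k W UA hWu hAu hα hα3 hα2 h33 h34 hpair hsmall m hm x ν
    exact h.1.trans_lt h.2
  · rw [norm_inv_mul_sub_one (hWu x ν)]
    exact (fine_pair L hL hd hG k W UA hWu hAu hα hα3 hα2 h33 h34 hpair hsmall x ν).2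

end

end Summit.QuantumFields.BalabanUV.T4Continuum.NE3.PairAxialGaugeB8
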